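import Mathlib

/-!
# Crux `RigidityForcesSymmetry.RigidMinimalRepr` (stmt-ValiantsHypothesis-4163), line `registered` —
# stub `stub_sourceBasis` (the source eigenbasis of an exact lift in the tight case)

Route `ValiantsHypothesis/RigidityForcesSymmetry`, crux `RigidMinimalRepr`, skeleton
`Cruxes/RigidMinimalRepr/Lines/registered.lean`, stub `stub_sourceBasis`.

**Statement.** Let `Λ, B, C` be endomorphisms of a finite-dimensional complex vector space `V` with
`B ∘ Λ = Λ ∘ C` (an exact lift `(B, C)` of the constant part `Λ` of a pencil), let `b` be a `B`-eigenbasis with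
weights `wt`, let `ker Λ = ℂ k₀` be a line on which `C` acts by a scalar `γ₀` different from every weight, and
suppose every basis vector `b i` with `i ≠ top` lies in `range Λ`.  Then `V` has a basis indexed by
`Option {i // i ≠ top}` consisting of `k₀` (at `none`) and `C`-eigenvectors `c i` of weight `wt i` with
`Λ (c i) = b i` (at `some i`).  In the pair of bases `(c, b)` the map `Λ` is a partial identity matrix.

**Proof.** Pick any preimage `c` of `b i`.  Applying `B ∘ Λ = Λ ∘ C` to `c` and using `B (b i) = wt i • b i`
gives `Λ (C c - wt i • c) = 0`, so `C c - wt i • c = a • k₀` for some scalar `a`; the corrected preimage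
`c + (a / (wt i - γ₀)) • k₀` is then a genuine `C`-eigenvector of weight `wt i` with the same image `b i`
(`sourceBasis_exists_eigenPreimages`).  The family `c` is linearly independent because `Λ ∘ c = b ∘ val` is, and
`k₀ ∉ span (range c)` because applying `Λ` to a relation `k₀ = ∑ aᵢ • cᵢ` gives `0 = ∑ aᵢ • b i`, forcing all
`aᵢ = 0` and `k₀ = 0`.  Hence `o ↦ o.casesOn' k₀ c` is linearly independent (`LinearIndependent.option`) of
cardinality `card (Option {i // i ≠ top}) = card ι = finrank V` (`Equiv.optionSubtypeNe`), so it is a basis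
(`basisOfLinearIndependentOfCardEqFinrank`).
-/

set_option autoImplicit false

-- the mandated summit-side namespace repeats a component by design (single-problem summit)
set_option linter.dupNamespace false

noncomputable section

namespace Summit.ValiantsHypothesis.ValiantsHypothesis.Theorems.RigidityForcesSymmetryRigidMinimalRepr

/-- **Corrected preimages.** If `B ∘ Λ = Λ ∘ C`, `b` is a family of `B`-eigenvectors `B (b i) = wt i • b i`,
`ker Λ` is the line through `k₀` on which `C` acts by `γ₀ ≠ wt i`, and every `b i` (`i ≠ top`) lies in
`range Λ`, then every such `b i` has a preimage under `Λ` which is a `C`-eigenvector of weight `wt i`: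
a preimage `c` satisfies `Λ (C c - wt i • c) = B (b i) - wt i • b i = 0`, so `C c - wt i • c = a • k₀`, and
`c + (a / (wt i - γ₀)) • k₀` works. -/
theorem sourceBasis_exists_eigenPreimages {V : Type*} [AddCommGroup V] [Module ℂ V]
    (Λ B C : Module.End ℂ V) (hcomm : B ∘ₗ Λ = Λ ∘ₗ C) {ι : Type*}
    (b : Module.Basis ι ℂ V) (wt : ι → ℂ) (hB : ∀ i, B (b i) = wt i • b i)
    (γ₀ : ℂ) (hγ : ∀ i, wt i ≠ γ₀) (k₀ : V)
    (hker : ∀ v, Λ v = 0 ↔ ∃ a : ℂ, v = a • k₀) (hCk : C k₀ = γ₀ • k₀)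
    (top : ι) (hrange : ∀ i, i ≠ top → b i ∈ LinearMap.range Λ) :
    ∃ c : {i : ι // i ≠ top} → V, (∀ i, Λ (c i) = b i.1) ∧ ∀ i, C (c i) = wt i.1 • c i := by
  have hΛk : Λ k₀ = 0 := (hker k₀).2 ⟨1, (one_smul ℂ k₀).symm⟩
  have key : ∀ i : {i : ι // i ≠ top}, ∃ c : V, Λ c = b i.1 ∧ C c = wt i.1 • c := by
    intro i
    obtain ⟨c, hc⟩ := LinearMap.mem_range.1 (hrange i.1 i.2)
    -- `B (Λ c) = Λ (C c)`
    have hBC : B (Λ c) = Λ (C c) := LinearMap.congr_fun hcomm c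
    have h1 : Λ (C c - wt i.1 • c) = 0 := by
      rw [map_sub, map_smul, ← hBC, hc, hB, sub_self]
    obtain ⟨a, ha⟩ := (hker _).1 h1
    have hw : wt i.1 - γ₀ ≠ 0 := sub_ne_zero.2 (hγ i.1)
    have hC : C c = wt i.1 • c + a • k₀ := by
      rw [← ha]
      abel
    have hs : a + a / (wt i.1 - γ₀) * γ₀ = wt i.1 * (a / (wt i.1 - γ₀)) := by
      field_simp
      ring
    refine ⟨c + (a / (wt i.1 - γ₀)) • k₀, ?_, ?_⟩
    · rw [map_add, map_smul, hΛk, smul_zero, add_zero, hc]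
    · calc C (c + (a / (wt i.1 - γ₀)) • k₀)
            = C c + (a / (wt i.1 - γ₀)) • C k₀ := by rw [map_add, map_smul]
        _ = wt i.1 • c + (a + a / (wt i.1 - γ₀) * γ₀) • k₀ := by
              rw [hC, hCk, smul_smul, add_smul, add_assoc]
        _ = wt i.1 • (c + (a / (wt i.1 - γ₀)) • k₀) := by rw [hs, smul_add, smul_smul]
  choose c hc₁ hc₂ using key
  exact ⟨c, hc₁, hc₂⟩

/-- **Stub `stub_sourceBasis` of line `registered` for crux `RigidMinimalRepr`** (registered form): the source
eigenbasis of an exact lift in the tight case.  With `B ∘ Λ = Λ ∘ C`, a `B`-eigenbasis `b` of weights `wt`,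
`ker Λ = ℂ k₀` with `C k₀ = γ₀ • k₀`, `γ₀` different from every weight, and all `b i` (`i ≠ top`) in `range Λ`,
there is a basis `cs` of `V` indexed by `Option {i // i ≠ top}` with `cs none = k₀`, `Λ (cs (some i)) = b i`
and `C (cs (some i)) = wt i • cs (some i)`. -/
theorem stub_sourceBasis {V : Type*} [AddCommGroup V] [Module ℂ V] [FiniteDimensional ℂ V]
    (Λ B C : Module.End ℂ V) (hcomm : B ∘ₗ Λ = Λ ∘ₗ C) {ι : Type*} [Fintype ι] [DecidableEq ι]
    (b : Module.Basis ι ℂ V) (wt : ι → ℂ) (hB : ∀ i, B (b i) = wt i • b i)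
    (γ₀ : ℂ) (hγ : ∀ i, wt i ≠ γ₀) (k₀ : V) (hk₀ : k₀ ≠ 0)
    (hker : ∀ v, Λ v = 0 ↔ ∃ a : ℂ, v = a • k₀) (hCk : C k₀ = γ₀ • k₀)
    (top : ι) (hrange : ∀ i, i ≠ top → b i ∈ LinearMap.range Λ) :
    ∃ cs : Module.Basis (Option {i : ι // i ≠ top}) ℂ V,
      cs none = k₀ ∧ (∀ i, Λ (cs (some i)) = b i.1) ∧ ∀ i, C (cs (some i)) = wt i.1 • cs (some i) := by
  obtain ⟨c, hΛc, hCc⟩ :=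
    sourceBasis_exists_eigenPreimages Λ B C hcomm b wt hB γ₀ hγ k₀ hker hCk top hrange
  have hΛk : Λ k₀ = 0 := (hker k₀).2 ⟨1, (one_smul ℂ k₀).symm⟩
  -- `b ∘ val` is linearly independent, hence so is its lift `c` through `Λ`
  have hbli : LinearIndependent ℂ (fun i : {i : ι // i ≠ top} => b i.1) :=
    b.linearIndependent.comp _ Subtype.val_injective
  have hcli : LinearIndependent ℂ c := by
    refine LinearIndependent.of_comp Λ ?_
    have hcomp : (⇑Λ ∘ c) = fun i : {i : ι // i ≠ top} => b i.1 := funext hΛc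
    rw [hcomp]
    exact hbli
  -- `k₀` is not in the span of `c`: apply `Λ` to a relation and use the independence of `b ∘ val`
  have hk₀span : k₀ ∉ Submodule.span ℂ (Set.range c) := by
    intro hmem
    obtain ⟨a, ha⟩ := (Submodule.mem_span_range_iff_exists_fun ℂ).1 hmem
    have h0 : ∑ i, a i • b i.1 = 0 := by
      have hΛ := congrArg Λ ha
      rw [map_sum, hΛk] at hΛ
      simpa only [map_smul, hΛc] using hΛ
    have ha0 : ∀ i, a i = 0 := Fintype.linearIndependent_iff.1 hbli a h0
    apply hk₀
    rw [← ha]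
    exact Finset.sum_eq_zero fun i _ => by rw [ha0 i, zero_smul]
  have hli : LinearIndependent ℂ (fun o : Option {i : ι // i ≠ top} => Option.casesOn' o k₀ c) :=
    hcli.option hk₀span
  have hcard : Fintype.card (Option {i : ι // i ≠ top}) = Module.finrank ℂ V := by
    rw [Fintype.card_congr (Equiv.optionSubtypeNe top), Module.finrank_eq_card_basis b]
  set cs : Module.Basis (Option {i : ι // i ≠ top}) ℂ V := basisOfLinearIndependentOfCardEqFinrank hli hcard
    with hcs_def
  have hcs : ⇑cs = fun o : Option {i : ι // i ≠ top} => Option.casesOn' o k₀ c :=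
    coe_basisOfLinearIndependentOfCardEqFinrank hli hcard
  have hnone : cs none = k₀ := congrFun hcs none
  have hsome : ∀ i, cs (some i) = c i := fun i => congrFun hcs (some i)
  refine ⟨cs, hnone, fun i => ?_, fun i => ?_⟩
  · rw [hsome]
    exact hΛc i
  · rw [hsome]
    exact hCc i

end Summit.ValiantsHypothesis.ValiantsHypothesis.Theorems.RigidityForcesSymmetryRigidMinimalRepr

end
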